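import Mathlib
import HarnessLib
import Literature.Geometry.Lorentzian.FinalState
import Literature.Geometry.Lorentzian.CauchyDevelopment
import Literature.Geometry.Lorentzian.KerrConvergence
import Literature.Geometry.Lorentzian.KerrSchild
import Literature.Uncategorized.HonestCore
import Literature.Uncategorized.LateEscape
import Literature.Uncategorized.SubwallClosureOfNoEscape

/-!
# S4a — sub-wall closedness of late tube images from "no late escape"

Stub `stub_subwallClosureOfNoEscape` of the `NeckGapDecay` skeleton (route StarvedNecks, line Sketch):
topology/bookkeeping only.

Main declarations: `SubwallClosureOfNoEscape` (the statement registered as stub S4a, a verbatim copy of the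
skeleton's; its hypothesis bundles `HonestCore` and `LateEscape`, verbatim the skeleton's, are the Literature-level
`Literature.Uncategorized.HonestCore` / `Literature.Uncategorized.LateEscape`) and
`stub_subwallClosureOfNoEscape : Literature.Uncategorized.SubwallClosureOfNoEscape`.

CLAIM.  In a vacuum Cauchy development `𝒟`, for a `C⁴` final-state decomposition `d` of `O` with
`HonestCore(d, R₀)`, a hole `i` (background `B = boostedKerr(Λ, c, M, a)`, chart time `t`, radius `r`),
`R₀ ≤ R₁`, `τ₀ ≤ τ₁`, a wall `W`, a chart `Ψg` continuous on the tube `U = {τ₁ < t, r < W(x⁰) + 1}` (G1)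
and equal to the input chart `Ψᵢ` inside `R₁ + 1` (G2): if from `τ₂ ≥ τ₁` there is no late escaping
sequence, then for `τ' > τ₂` and a continuous sub-wall profile `ϱ` the image `A = Ψg(S)`,
`S = {τ' ≤ t, r ≤ ϱ(t)}`, satisfies `closure A ∩ O ⊆ A`.

PROOF.  The carrier is a metrizable manifold (`Manifold.metrizableSpace`), so a point `p ∈ closure A ∩ O`
is the limit of `Ψg xₙ`, `xₙ ∈ S`.
* If frequently `r(xₙ) ≤ R₁ + 1`, then along those indices `Ψg xₙ = Ψᵢ xₙ` with `xₙ` in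
  `S' = {τ' ≤ t, r ≤ min(ϱ(t), R₁ + 1)}`, so `p ∈ closure Ψᵢ(S') ∩ O ⊆ Ψᵢ(S')` by clause (3) of
  `HonestCore` (profile `min(ϱ, R₁ + 1)`), and `Ψᵢ = Ψg` on `S' ⊆ S`.
* Otherwise eventually `r(xₙ) > R₁ + 1`.  If `t(xₙ) → ∞`, a tail of `(xₙ)` is a late escaping sequence
  (`τ₂ ≤ t`, `R₁ + 1 ≤ r ≤ W(x⁰)` by the sub-wall property, `Ψg xₙ → p ∈ O`): excluded.  If not,
  frequently `t(xₙ) < T`, so frequently `xₙ` lies in the preimage under the rest-frame homeomorphism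
  `y ↦ Λ⁻¹(y − c)` of the compact box `{τ' ≤ z⁰ ≤ T, R₁ + 1 ≤ r(z) ≤ ϱ(z⁰)}` (closed; bounded since
  `‖z‖² = (z⁰)² + ‖z̃‖² ≤ (z⁰)² + r² + a²`), which lies in the domain (`r ≥ R₁ + 1 > 2M ≥ r₊`); a
  subsequence converges to some `q ∈ S ⊆ U`, and continuity of `Ψg` on `U` with uniqueness of limits
  gives `p = Ψg q ∈ A`.

References: general topology (Mathlib); Visser arXiv:0706.0622, (35) for the Kerr–Schild radius.
-/

noncomputable section

open scoped Manifold ContDiff Topology ENNReal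
open Filter Set MeasureTheory Topology Literature.Geometry.Lorentzian Literature.Uncategorized

namespace Summit.FinalStateConjecture.FinalStateConjecture.Theorems.NeckGapDecay.ConnectionLevelCones.SubwallClosureStub
-- the problem namespace `Summit.FinalStateConjecture.FinalStateConjecture` repeats the summit name by design
set_option linter.dupNamespace false

/-- `‖z‖² = (z⁰)² + ‖z̃‖²` on `E4` (coordinate bookkeeping). [folklore] -/
private theorem norm_sq_eq (z : E4) : ‖z‖ ^ 2 = z 0 ^ 2 + E4.spatialNorm z ^ 2 := by
  rw [E4.spatialNorm_sq, EuclideanSpace.real_norm_sq_eq, Fin.sum_univ_four]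
  ring

/-- `‖z̃‖² ≤ r² + a²` for the Kerr–Schild radius (`r² = ((ρ² − a²) + √D)/2`, `√D ≥ |ρ² − a²|`). [folklore] -/
private theorem spatialNorm_sq_le (a : ℝ) (z : E4) :
    E4.spatialNorm z ^ 2 ≤ Kerr.radius a z ^ 2 + a ^ 2 := by
  rw [Kerr.radius_sq]
  have h := Kerr.abs_le_sqrt_radius_discr a z
  have h' := le_abs_self (E4.spatialNorm z ^ 2 - a ^ 2)
  linarith

/-- `r₊ ≤ 2M` for `M ≥ 0`. [folklore] -/
private theorem rPlus_le_two_mul {M : ℝ} (hM : 0 ≤ M) (a : ℝ) : Kerr.rPlus M a ≤ 2 * M := by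
  unfold Kerr.rPlus
  have h : √(M ^ 2 - a ^ 2) ≤ M :=
    (Real.sqrt_le_sqrt (by nlinarith [sq_nonneg a])).trans_eq (Real.sqrt_sq hM)
  linarith

/-- The rest-frame coordinate box `{τ' ≤ z⁰ ≤ T, R ≤ r(z) ≤ ϱ(z⁰)}` is compact (closed, and bounded by
`‖z‖² = (z⁰)² + ‖z̃‖² ≤ (z⁰)² + r² + a²`). [folklore] -/
private theorem isCompact_restBox (a : ℝ) {ϱ : ℝ → ℝ} (hϱ : Continuous ϱ) (τ' T R : ℝ) :
    IsCompact {z : E4 | τ' ≤ z 0 ∧ z 0 ≤ T ∧ R ≤ Kerr.radius a z ∧ Kerr.radius a z ≤ ϱ (z 0)} := by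
  have h0 : Continuous fun z : E4 ↦ z 0 := by fun_prop
  have hr := Kerr.continuous_radius a
  refine Metric.isCompact_of_isClosed_isBounded ?_ ?_
  · exact (isClosed_le continuous_const h0).and <| (isClosed_le h0 continuous_const).and <|
      (isClosed_le continuous_const hr).and (isClosed_le hr (hϱ.comp h0))
  · obtain ⟨C, hC⟩ := isCompact_Icc.exists_bound_of_continuousOn (hϱ.continuousOn (s := Icc τ' T))
    rw [isBounded_iff_forall_norm_le]
    refine ⟨|τ'| + |T| + |C| + |a|, ?_⟩
    rintro z ⟨h1, h2, -, h4⟩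
    have hC' : ϱ (z 0) ≤ |C| :=
      (le_abs_self _).trans (((Real.norm_eq_abs _).symm.trans_le (hC (z 0) ⟨h1, h2⟩)).trans (le_abs_self C))
    have hr0 := Kerr.radius_nonneg a z
    have hz0 : |z 0| ≤ |τ'| + |T| :=
      abs_le.2 ⟨by linarith [neg_abs_le τ', abs_nonneg T], by linarith [le_abs_self T, abs_nonneg τ']⟩
    have hrad : Kerr.radius a z ^ 2 ≤ |C| ^ 2 := pow_le_pow_left₀ hr0 (h4.trans hC') 2
    have hsp := spatialNorm_sq_le a z
    have hn : ‖z‖ ^ 2 ≤ (|τ'| + |T| + |C| + |a|) ^ 2 := by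
      rw [norm_sq_eq]
      nlinarith [abs_nonneg C, abs_nonneg a, abs_nonneg τ', abs_nonneg T, sq_abs (z 0), sq_abs a,
        abs_nonneg (z 0)]
    exact (pow_le_pow_iff_left₀ (norm_nonneg z) (by positivity) two_ne_zero).1 hn

/-! ## The stub -/

/-- Registered stub S4a (soft, M–L; worker): sub-wall closedness of the late tube images from "no late
escape".  Sequences (the development is a metrizable manifold); inside `R₁+1` clause `Hc`(3) for the input
chart with profile `min ϱ (R₁+1)`; outside, either the chart times escape (a late escaping sequence,
excluded) or a subsequence stays in a compact coordinate box inside the tube, where `Ψg` is continuous.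
[folklore] -/
theorem stub_subwallClosureOfNoEscape : Literature.Uncategorized.SubwallClosureOfNoEscape := by
  intro X _ _ _ _ D 𝒟 O d R₀ hc i R₁ τ₁ W Ψg B t r hR hτ _hW hG1 hG2 τ₂ hτ₂ hne τ' ϱ hϱ hτ' hsub
  rintro p ⟨hpcl, hpO⟩
  -- topology of the development: a metrizable manifold
  haveI : LocallyCompactSpace 𝒟.carrier :=
    Manifold.locallyCompact_of_finiteDimensional (M := 𝒟.carrier) (𝓡 4)
  haveI : TopologicalSpace.MetrizableSpace 𝒟.carrier := Manifold.metrizableSpace (𝓡 4) 𝒟.carrier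
  -- the data
  obtain ⟨hc1, -, hc3, -⟩ := hc
  obtain ⟨-, hM100, -⟩ := hc1 i
  have hM : 0 < d.mass i := d.mass_pos i
  obtain ⟨hsmooth, -, -⟩ := hG1
  have hdom : ∀ y : E4, R₁ + 1 ≤ r y → y ∈ B.domain := by
    intro y hy
    have hry : r y = Kerr.radius (d.spin i) (poincareInv (d.motion i).1 (d.motion i).2 y) := rfl
    show poincareInv (d.motion i).1 (d.motion i).2 y ∈ Kerr.exterior (d.mass i) (d.spin i)
    rw [Kerr.mem_exterior, ← hry]
    refine max_lt ?_ ?_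
    · linarith [rPlus_le_two_mul hM.le (d.spin i)]
    · linarith
  -- a sequence of the tube portion with images converging to `p`
  obtain ⟨cs, hcS, hcp⟩ := mem_closure_iff_seq_limit.1 hpcl
  choose x hxS hxc using hcS
  have hlim : Tendsto (fun n ↦ Ψg (x n)) atTop (𝓝 p) := hcp.congr fun n ↦ (hxc n).symm
  by_cases hA : ∃ᶠ n in atTop, r (x n).1 ≤ R₁ + 1
  · -- Case 1: inside `R₁ + 1`, clause `Hc`(3) for the input chart with profile `min ϱ (R₁ + 1)`
    have hτ0' : d.τ₀ < τ' := by linarith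
    have h3 := hc3 i τ' (fun s ↦ min (ϱ s) (R₁ + 1)) (hϱ.min continuous_const) hτ0'
    have hfr : ∃ᶠ n in atTop,
        Ψg (x n) ∈ d.chart i '' {y | τ' ≤ t y.1 ∧ r y.1 ≤ min (ϱ (t y.1)) (R₁ + 1)} :=
      hA.mono fun n hn ↦ ⟨x n, ⟨(hxS n).1, le_min (hxS n).2 hn⟩, (hG2 _ hn).symm⟩
    have hp : p ∈ d.chart i '' {y | τ' ≤ t y.1 ∧ r y.1 ≤ min (ϱ (t y.1)) (R₁ + 1)} :=
      h3 ⟨mem_closure_of_frequently_of_tendsto hfr hlim, hpO⟩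
    obtain ⟨y, hy, hyp⟩ := hp
    exact ⟨y, ⟨hy.1, hy.2.trans (min_le_left _ _)⟩, (hG2 y (hy.2.trans (min_le_right _ _))).trans hyp⟩
  · have hev : ∀ᶠ n in atTop, R₁ + 1 < r (x n).1 := by
      simpa only [not_frequently, not_le] using hA
    by_cases hT : Tendsto (fun n ↦ t (x n).1) atTop atTop
    · -- Case 2b: a late escaping sequence, excluded by hypothesis
      exfalso
      obtain ⟨N, hN⟩ := eventually_atTop.1 hev
      refine hne ⟨fun n ↦ x (n + N), p, hpO, hT.comp (tendsto_add_atTop_nat N), fun n ↦ ?_,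
        hlim.comp (tendsto_add_atTop_nat N)⟩
      have h1 := hxS (n + N)
      exact ⟨hτ'.le.trans h1.1, (hN (n + N) (Nat.le_add_left N n)).le, hsub _ h1.1 h1.2⟩
    · -- Case 2a: bounded chart times along a subsequence; a compact coordinate box inside the tube
      simp only [tendsto_atTop, not_forall, not_eventually, not_le] at hT
      obtain ⟨T, hfrT⟩ := hT
      -- the rest-frame coordinates `y ↦ Λ⁻¹ (y − c)` as a homeomorphism of `E4`
      obtain ⟨e, he⟩ : ∃ e : E4 ≃ₜ E4, ∀ y, e y = poincareInv (d.motion i).1 (d.motion i).2 y :=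
        ⟨(Homeomorph.subRight (d.motion i).2).trans ((d.motion i).1 : E4 ≃L[ℝ] E4).symm.toHomeomorph,
          fun _ ↦ rfl⟩
      have ht_e : ∀ y, t y = e y 0 := fun y ↦ by rw [he]; rfl
      have hr_e : ∀ y, r y = Kerr.radius (d.spin i) (e y) := fun y ↦ by rw [he]; rfl
      have hKc : IsCompact ((Subtype.val : B.domain → E4) ⁻¹' (e ⁻¹'
          {z : E4 | τ' ≤ z 0 ∧ z 0 ≤ T ∧ R₁ + 1 ≤ Kerr.radius (d.spin i) z ∧
            Kerr.radius (d.spin i) z ≤ ϱ (z 0)})) := by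
        refine Topology.IsInducing.subtypeVal.isCompact_preimage'
          (e.isCompact_preimage.2 (isCompact_restBox (d.spin i) hϱ τ' T (R₁ + 1))) ?_
        rintro y ⟨-, -, h3, -⟩
        exact ⟨⟨y, hdom y (by rw [hr_e]; exact h3)⟩, rfl⟩
      have hfreq : ∃ᶠ n in atTop, x n ∈ (Subtype.val : B.domain → E4) ⁻¹' (e ⁻¹'
          {z : E4 | τ' ≤ z 0 ∧ z 0 ≤ T ∧ R₁ + 1 ≤ Kerr.radius (d.spin i) z ∧
            Kerr.radius (d.spin i) z ≤ ϱ (z 0)}) := by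
        refine (hfrT.and_eventually hev).mono fun n hn ↦ ?_
        obtain ⟨hnT, hnR⟩ := hn
        obtain ⟨h1, h2⟩ := hxS n
        rw [ht_e] at hnT h1 h2
        rw [hr_e] at hnR h2
        exact ⟨h1, hnT.le, hnR.le, h2⟩
      obtain ⟨q, hq, φ, hφ, hφlim⟩ := hKc.tendsto_subseq' hfreq
      obtain ⟨hq1, -, -, hq4⟩ := hq
      rw [← ht_e] at hq1 hq4
      rw [← hr_e] at hq4
      -- `q` and the whole sequence lie in the tube `U`, where `Ψg` is continuous
      have hSU : ∀ y : B.domain, τ' ≤ t y.1 → r y.1 ≤ ϱ (t y.1) →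
          y ∈ ({x | τ₁ < t x.1 ∧ r x.1 < W (x.1 0) + 1} : Set B.domain) := fun y h1 h2 ↦
        ⟨by linarith, by linarith [hsub y h1 h2]⟩
      have hcont : ContinuousWithinAt Ψg {x | τ₁ < t x.1 ∧ r x.1 < W (x.1 0) + 1} q :=
        hsmooth.continuousOn q (hSU q hq1 hq4)
      have hin : Tendsto (x ∘ φ) atTop (𝓝[{x | τ₁ < t x.1 ∧ r x.1 < W (x.1 0) + 1}] q) :=
        tendsto_nhdsWithin_iff.2 ⟨hφlim, Eventually.of_forall fun n ↦ hSU _ (hxS (φ n)).1 (hxS (φ n)).2⟩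
      have hl1 : Tendsto (fun n ↦ Ψg (x (φ n))) atTop (𝓝 (Ψg q)) := hcont.tendsto.comp hin
      have hl2 : Tendsto (fun n ↦ Ψg (x (φ n))) atTop (𝓝 p) := hlim.comp hφ.tendsto_atTop
      exact ⟨q, ⟨hq1, hq4⟩, tendsto_nhds_unique hl1 hl2⟩

end Summit.FinalStateConjecture.FinalStateConjecture.Theorems.NeckGapDecay.ConnectionLevelCones.SubwallClosureStub

end
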